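import Literature.MathematicalPhysics.QuantumFieldTheory.Balaban1983to89.Node00.N24KnitAllChildren

/-!
# NODE N24 · ALL THIRTEEN CHILDREN BY NAME AT THE STAGE-5 RECORD OF RECORD `₅C` — the currency of the Stage-₉ SHADOW refinement (seat n23-a,
# `T4DatumAssemblyTowerShadow`: «₉ → ₅C at the shadow; your ₅C-keyed knits need NO ₉C twins») — with N09 through its PINNED B12-GROUP SOCKET + its [Balaban1987RG1]
# THEOREM-3 MEMBER displayed at the world, and N13 through [Balaban1988Convergent] COR. 3's FIVE LEAVES AT `D.C` (n13-a `b16_main_of_isRecordOfRecord₅C_of_leaf`)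

TRACK A (YM-PLAN §2d, node N24 of 28 = binder B2 `hB : B16.EndStatementBPrinted D.C`), seat `pub-ymgap-dag-n24-a` (-a KNIT-BY-NAME).  FIFTEENTH N24 module, a NEW importing one
(append-only growth; modules 1–14 untouched).  THEOREMS ONLY, def-free, sorry-free, standard axioms.

WHY.  Module 14 (`N24KnitAllChildren`) entered every child by name at the STAGE-8 record `₈C`, where N09 has n09-a's theorem `B12NodeKnitRecord8.b12_main_at_record₈C_of_leaf`
(slots over Stage-8 parameters); at `₅C` it kept N09 as the one pure binder (`N24_binder₅C_N09`).  Two reasons to finish the `₅C` list as well: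
(1) seat n23-a's located design point for `Record9` (INTENT-1 `T4DatumAssemblyTowerShadow`, 2026-08-26): the field-by-field refinement «₉C → ₅C» holds AT THE SHADOW
(`isRecordOfRecord₅C_shadow`), NOT «₉C → ₈C» (the shadow's residual `R` is the Radon–Nikodym-induced one, not `θ₈.toStage5`'s) — so the `₅C`-keyed theorems are the ones
the Stage-₉ glue will consume, and every child should be enterable there by name; (2) N09 at a `₅C` record IS «its own leaf `b12` + its Theorem-3 member» given the in-edges
(`B12NodeKnitRecord8.b12_main_of_leaf_of_thm3Member`, n09-a), and the leaf `b12` of the binding of record unfolds (`Iff.rfl`) to [Balaban1987RG1] Lemma 4 (3.53) over the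
B12 group `(F12, c12)` of the residual bundle `θ.res.X P` — a pinned carrier socket exactly like module 14's; the Theorem-3 member `(leavesP w P).smallCouplings →
(leavesP w P).smallFieldInductive` (= `(w.C P).IndAss k` for `k ≤ K` along in-interval runs — (1.1) ∧ (1.3) of the CONSTRUCTION, no free carrier) is displayed as is
(at Stage 8 n09-a derives it from [B11] Thm 1 at the record's domains + `HCompT`).  Also N13 gets its node-faithful display: instead of datum-indexed exponent
families `eM eP` and the θ-form `hcor`, the hypothesis is «for SOME exponent letters `(e₋, e₊)` and SOME representation family `R : B14Cor3.ReprFamily D.C`, the five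
Cor.-3 leaves `LeafH ∕ LeafU1 ∕ LeafU2 (e₊) ∕ LeafL1 ∕ LeafL2 (e₋)` at `(D.C, w.γ)`» — n13-a's `B16NodeKnitRecordPinned.b16_main_of_isRecordOfRecord₅C_of_leaf` at the world re-lettered
to `(e₋, e₊)` (`N24_isRecordOfRecord₅C_withExp`; (B2) does not read the world's exponent letters, module 5's `N24_at_record₅C_of_N13_exists`).

WHAT THIS FILE PROVES.
§0 `N24_forall_pinned_b12Leaf_iff₅C` (pinned B12-group socket ↔ the world's leaf `b12`); `N24_b12_main_of_isRecordOfRecord₅C_of_slot` (N09 at a `₅C` record from the socket + the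
   Theorem-3 member); `N24_b16_main_withExp_of_cor3Leaves₅C` (N13 at the exponent-re-lettered `₅C` record world from the 𝐑-leaf and the five Cor.-3 leaves).
§1 **`N24_at_record₅C_knit_all₁₃_pinned`** — (B2) at a `₅C` record, ALL THIRTEEN children by name: N01–N04 theorems; N05 N06 N07 N08 N09(b12) N10 N11 N12 pinned sockets ∕
   record slots; N09's Theorem-3 member `hT3`; N13's `hR` + `hcor3`; β-box on `D.βfun` over `]0, γ₀]`.  `N24_stabilityB_itemShape₅C_knit_all₁₃_pinned` (item-19183 body shape).
§2 `₈C` twins by refinement: `N24_at_record₈C_knit_all₁₃_pinned`, `N24_at_record₈C_knit_all₁₃_of_betaMerged_pinned` (merged β of record on `]0, w.γ]`).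
§3 GIVEN B3: `N24_lowered_slots₅C_of_betaPertH_pinned` — the seven γ-blind sockets ∕ slots + `hR` at `w`; at the explicit γ-lowered `₅C` world `w'`: `hT3`, N11's slots, `hcor3` ⇒ (B2).
WHICH CHILD BLOCKS at `₅C` after this file (kernel form = hypotheses of `N24_at_record₅C_knit_all₁₃_pinned`): NO pure node binder.  THEOREMS — N01 N02 N03 N04 N23, `hC`, `hγ`,
guarded (0.20).  DISPLAYED — eight carrier sockets ∕ slots on `Residual₅` (X: [B8] group, [B10] run family, B12 group, B13 group; Y; Z; V∕R∕S218∕E (N11); W), N09's Theorem-3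
member at the world (the construction's (1.1) ∧ (1.3) along in-interval runs), N13's 𝐑-leaf + «∃ (e₋, e₊) R, five Cor.-3 leaves at D.C», the β-box (NODE O ∕ [I] p. 264) or B3 (§3).
HONEST FRAMING: kernel bookkeeping BY NAME; every slot a displayed HYPOTHESIS (each socket ↔ the world's own leaf at a record — satisfiable exactly when the leaves are);
nothing of Bałaban's asserted; N24 COMPOSITE — no discharge, no count; one finite T⁴ programme at fixed ε; NOT continuum ∕ ℝ⁴ ∕ OS ∕ mass gap ∕ Clay.
-/

noncomputable section

open scoped Matrix.Norms.L2Operator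

namespace Literature.MathematicalPhysics.QuantumFieldTheory.Balaban1983to89.Node00

open DagBinding T4Continuum T4DatumAssembly FlowStepRuns AveragingRT
open FlowStep (BetaPertH box_mono)

variable {F : T4Family} {N : ℕ} [NeZero N] {D : FiniteEpsData F (SU N)} {w : WorldP}

/-! ## §0. The pinned B12-group socket; N09 and N13 at a `₅C` record in node-faithful form -/

/-- **The pinned B12-group socket IS the world's leaf `b12`**: at a `₅C` record, «for the admissible Stage-5 parameters of the datum that bind the world, [Balaban1987RG1] Lemma 4
(3.53) over the B12 group of their residual bundle, `B12Sec2to5.Lemma4Printed (θ.res.X P).F12 (θ.res.X P).c12`» ↔ `∀ P, (w.up P).b12` (the `b12` field of the binding of record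
unfolds to it, `Iff.rfl`: `Record5C.upOfRecord₅C_leaves`, `B12NodeKnit.carriers₃_groupB12`; Stage-8 reading n09-a's `B12NodeKnitRecord8.b12_leaf_stage8_iff`).
[cite: Balaban1987RG1, Lemma 4 (3.53) p.280 (the leaf; bookkeeping: the pinned socket)] -/
theorem N24_forall_pinned_b12Leaf_iff₅C (h : IsRecordOfRecord₅C F N D w) :
    (∀ θ : Stage5Params F N, θ.Admissible → D = datumOfRecord₅ F N θ → (∀ P, w.up P = upOfRecord₅C F N θ P) → ∀ P : B12.RunParams,
        B12Sec2to5.Lemma4Printed (θ.res.X P).F12 (θ.res.X P).c12) ↔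
      ∀ P : B12.RunParams, (w.up P).b12 := by
  refine ⟨fun hX P => ?_, fun hw θ' _ _ hup' P => ?_⟩
  · obtain ⟨θ, hθ, hD, -, -, -, hup⟩ := h
    rw [hup P]
    exact hX θ hθ hD hup P
  · have h12 : (w.up P).b12 := hw P
    rw [hup' P] at h12
    exact h12

/-- **N09 · [Balaban1987RG1] at every run of a `₅C` record from the pinned B12-group socket and the THEOREM-3 MEMBER at the world** (`B12NodeKnitRecord8.b12_main_of_leaf_of_thm3Member`,
n09-a: the in-edges `b4 … b11`, `b13` are not used).  `hT3 P : (leavesP w P).smallCouplings → (leavesP w P).smallFieldInductive` is (1.1) ∧ (1.3) of the world's construction along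
in-interval runs (`∀ k ≤ K, (w.C P).IndAss k`) — at Stage 8 a consequence of [B11] Thm 1 at the record's domains + the composition clauses (`B12NodeKnitRecord8.thm3Member_at_record₈C_of_hCompT`).
[cite: Balaban1987RG1, Thm 1 p.259, Thm 3 p.264 and Lemma 4 (3.53) p.280 (node bookkeeping at the record)] -/
theorem N24_b12_main_of_isRecordOfRecord₅C_of_slot (h : IsRecordOfRecord₅C F N D w)
    (slots₀₉ : ∀ θ : Stage5Params F N, θ.Admissible → D = datumOfRecord₅ F N θ → (∀ P, w.up P = upOfRecord₅C F N θ P) → ∀ P : B12.RunParams,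
      B12Sec2to5.Lemma4Printed (θ.res.X P).F12 (θ.res.X P).c12)
    (hT3 : ∀ P : B12.RunParams, (leavesP w P).smallCouplings → (leavesP w P).smallFieldInductive)
    (P : B12.RunParams) : Dag.B12_main (leavesP w P) :=
  B12NodeKnitRecord8.b12_main_of_leaf_of_thm3Member ((N24_forall_pinned_b12Leaf_iff₅C h).1 slots₀₉ P) (hT3 P)

/-- **N13 · [Balaban1989LargeFieldII] Thm 1 + Cor. 3 at the EXPONENT-RE-LETTERED `₅C` record world, from the 𝐑-leaf and the five Cor.-3 leaves at `D.C`**: given exponent letters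
`(e₋, e₊)`, a representation family `R : B14Cor3.ReprFamily D.C` with `LeafH ∕ LeafU1 ∕ LeafU2 (e₊) ∕ LeafL1 ∕ LeafL2 (e₋)` at `(D.C, w.γ)`, and the world's 𝐑-leaf, N13 holds at every
run of `{ w with em := e₋, ep := e₊ }` — n13-a's `B16NodeKnitRecordPinned.b16_main_of_isRecordOfRecord₅C_of_leaf` at that world (again a `₅C` record over `D`, module 5's
`N24_isRecordOfRecord₅C_withExp`). [cite: Balaban1989LargeFieldII, Thm 1 p.355, p.387, p.391; Balaban1988Convergent, p.244, Cor. 3 (2.50) p.264 (node bookkeeping at the record)] -/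
theorem N24_b16_main_withExp_of_cor3Leaves₅C (h : IsRecordOfRecord₅C F N D w) (hR : ∀ P : B12.RunParams, (w.up P).rOperation) (em ep : ℝ → ℝ)
    (R : B14Cor3.ReprFamily D.C) (hH : B14Cor3.LeafH D.C R w.γ) (hU1 : B14Cor3.LeafU1 D.C R w.γ) (hU2 : B14Cor3.LeafU2 D.C R w.γ ep)
    (hL1 : B14Cor3.LeafL1 D.C R w.γ) (hL2 : B14Cor3.LeafL2 D.C R w.γ em) :
    ∀ P : B12.RunParams, Dag.B16_main (leavesP { w with em := em, ep := ep } P) :=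
  B16NodeKnitRecordPinned.b16_main_of_isRecordOfRecord₅C_of_leaf (N24_isRecordOfRecord₅C_withExp h em ep) hR R hH hU1 hU2 hL1 hL2

/-! ## §1. At `₅C`: ALL THIRTEEN children by name -/

/-- **N24 · (B2) at the Stage-5 record of record, ALL THIRTEEN PAPER CHILDREN ENTERED BY NAME** — N01 N02 N04 (`Record5C`), N03 (`N03_at_record₅C`); N05 N06 N07 N12 pinned carrier sockets
(module 14 §0, `B11LeafUnpinnedRecord`); N08 N10 N11 record slots (modules 9 ∕ 11); N09 the pinned B12-group socket `slots₀₉` + the Theorem-3 member `hT3` (§0); N13 the world's 𝐑-leaf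
`hR` + «∃ (e₋, e₊) R, the five Cor.-3 leaves at `(D.C, w.γ)`» `hcor3` (§0); β-box `w.b ≤ D.βfun ≤ w.βup` on `]0, γ₀]^{k+1}`.  Composition: module 5's `N24_at_record₅C_of_N13_exists`.
NO pure `Dag.Bk_main` binder remains at `₅C`. [cite: Balaban1989LargeFieldII, Thm 1 p.355 + pp.387, 391; Balaban1984PropagatorsII, pp.234–249; Balaban1985RegularSpaces, Thms 2, 4, 8 pp.83–101; Balaban1985BackgroundPropagators, Thms 3.1–3.15 pp.397–432; Balaban1985Variational, Thm 1 p.279; Balaban1985UV3, Thm 1 p.257 + Thm 2 p.272; Balaban1987RG1, Thm 1 p.259, Thm 3 p.264, Lemma 4 (3.53) p.280, (1.22) p.264; Balaban1988RG2Cluster, Lemmas 1–3 pp.9, 11, 20; Balaban1988Convergent, Thm 1 p.262, Theorem p.245, p.244, Cor. 3 (2.50) p.264; Balaban1989LargeFieldI, Prop. 1 p.194 (bookkeeping over the Stage-5 record of record)] -/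
theorem N24_at_record₅C_knit_all₁₃_pinned (h : IsRecordOfRecord₅C F N D w) {γ₀ : ℝ} (hγ₀ : w.γ ≤ γ₀)
    (slots₀₅ : ∀ θ : Stage5Params F N, θ.Admissible → D = datumOfRecord₅ F N θ → (∀ P, w.up P = upOfRecord₅C F N θ P) → ∀ P : B12.RunParams,
      B8LeafR (θ.res.X P).d8 (θ.res.X P).L8 (θ.res.X P).C₂ (θ.res.X P).B₁' (θ.res.X P).B₀' (θ.res.X P).B₁ (θ.res.X P).B₂ (θ.res.X P).c₁
        (θ.res.X P).inp8 (θ.res.X P).B₀β (θ.res.X P).loc8 (θ.res.X P).fam8R (θ.res.X P).lan8 (θ.res.X P).cub8 (θ.res.X P).toAxial8)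
    (slots₀₆ : ∀ θ : Stage5Params F N, θ.Admissible → D = datumOfRecord₅ F N θ → (∀ P, w.up P = upOfRecord₅C F N θ P) → ∀ P : B12.RunParams,
      B9LeafX (θ.res.Y P))
    (slots₀₇ : ∀ θ : Stage5Params F N, θ.Admissible → D = datumOfRecord₅ F N θ → (∀ P, w.up P = upOfRecord₅C F N θ P) → ∀ P : B12.RunParams,
      B11Leaf (θ.res.Z P))
    (slots₀₈ : ∀ θ : Stage5Params F N, θ.Admissible → D = datumOfRecord₅ F N θ →
      (∀ P, w.up P = upOfRecord₅C F N θ P) → ∀ P : B12.RunParams,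
        ∃ (Xc : PrintedCarriersR) (I : Type) (C : B10Assembly.Consts) (T : I → B10.TowerRun),
          Nonempty (∀ i, B10Assembly.LeafSystem C (T i)) ∧ θ.res.X P = Xc.withTowerRuns10 T)
    (slots₀₉ : ∀ θ : Stage5Params F N, θ.Admissible → D = datumOfRecord₅ F N θ → (∀ P, w.up P = upOfRecord₅C F N θ P) → ∀ P : B12.RunParams,
      B12Sec2to5.Lemma4Printed (θ.res.X P).F12 (θ.res.X P).c12)
    (hT3 : ∀ P : B12.RunParams, (leavesP w P).smallCouplings → (leavesP w P).smallFieldInductive)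
    (slots₁₀ : ∀ θ : Stage5Params F N, θ.Admissible → D = datumOfRecord₅ F N θ →
      (∀ P, w.up P = upOfRecord₅C F N θ P) → ∀ P : B12.RunParams,
        B9LeafX (θ.res.Y P) →
          (B10.Thm1PrintedCompact (θ.res.X P).runs10 ∧ B10.Thm2Printed (θ.res.X P).runs10) →
            B11Leaf (θ.res.Z P) → B12Sec2to5.Lemma4Printed (θ.res.X P).F12 (θ.res.X P).c12 →
              B13.Lemma1Printed (θ.res.X P).S13 (θ.res.X P).c13 ∧ B13.Lemma2Printed (θ.res.X P).S13 (θ.res.X P).c13 ∧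
                B13.Lemma3Printed (θ.res.X P).S13 (θ.res.X P).c13)
    (slots₁₁ : ∀ θ : Stage5Params F N, θ.Admissible → D = datumOfRecord₅ F N θ →
      (∀ P, w.up P = upOfRecord₅C F N θ P) → ∀ P : B12.RunParams,
        ∃ S Scorr : (k : ℕ) → Density (F.P P.K) k (SU N) → Prop,
          (ROpLeaf (θ.res.V P) → B14.RAssumedP244 (θ.res.R P) Scorr S P.K) ∧
          (∀ k, k ≤ P.K → S k (densOfRecord₅ F N θ P k) → θ.res.S218 P k (densOfRecord₅ F N θ P k)) ∧
          ((leavesP w P).smallCouplings → S 0 (rhoZeroOfRecord F N P.K P.g0 (θ.res.E P))) ∧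
          ((leavesP w P).b7 → (leavesP w P).b8 → (leavesP w P).b9 → (leavesP w P).b10 → (leavesP w P).b11 →
            (leavesP w P).smallCouplings → (leavesP w P).smallFieldInductive → (leavesP w P).flowControl →
              ∀ k, k < P.K → S k (densOfRecord₅ F N θ P k) →
                Scorr (k + 1) (TrhoOfRecord F N P.K k (densOfRecord₅ F N θ P k))))
    (slots₁₂ : ∀ θ : Stage5Params F N, θ.Admissible → D = datumOfRecord₅ F N θ → (∀ P, w.up P = upOfRecord₅C F N θ P) → ∀ P : B12.RunParams,
      B15Leaf (θ.res.W P))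
    (hR : ∀ P : B12.RunParams, (w.up P).rOperation)
    (hcor3 : ∃ (em ep : ℝ → ℝ) (R : B14Cor3.ReprFamily D.C),
      B14Cor3.LeafH D.C R w.γ ∧ B14Cor3.LeafU1 D.C R w.γ ∧ B14Cor3.LeafU2 D.C R w.γ ep ∧ B14Cor3.LeafL1 D.C R w.γ ∧ B14Cor3.LeafL2 D.C R w.γ em)
    (hlo : FlowStep.BetaLowerH w.b γ₀ D.βfun) (hhi : FlowStep.BetaUpperH w.βup γ₀ D.βfun) :
    B16.EndStatementBPrinted D.C := by
  obtain ⟨em, ep, R, hH, hU1, hU2, hL1, hL2⟩ := hcor3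
  exact N24_at_record₅C_of_N13_exists h hγ₀ (N03_at_record₅C h) (N24_b8_main_of_isRecordOfRecord₅C_of_slot h slots₀₅)
    (N24_b9_main_of_isRecordOfRecord₅C_of_slot h slots₀₆)
    (B11LeafUnpinnedRecord.b11_main_of_isRecordOfRecord₅C_of_leaf h ((B11LeafUnpinnedRecord.forall_pinned_b11Leaf_iff₅C h).1 slots₀₇))
    (B10LeafUnpinnedRecord5C.b10_main_of_isRecordOfRecord₅C_of_slots h slots₀₈) (N24_b12_main_of_isRecordOfRecord₅C_of_slot h slots₀₉ hT3)
    (B13NodeKnitRecord5C.b13_main_of_isRecordOfRecord₅C h slots₁₀) (B14NodeKnitRecord5C.b14_main_of_isRecordOfRecord₅C h slots₁₁)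
    (N24_b15_main_of_isRecordOfRecord₅C_of_slot h slots₁₂) ⟨em, ep, N24_b16_main_withExp_of_cor3Leaves₅C h hR em ep R hH hU1 hU2 hL1 hL2⟩ hlo hhi

/-- **The item body (stmt-QuantumFields-19183 `StabilityBAtRecord`, rev 0) in its LITERAL SHAPE at general `N`, at the Stage-5 record of record, all thirteen children by name**:
`IsDatumOfRecord₀ F N D ∧ B16.EndStatementBPrinted D.C ∧ ∃ γ₁ > 0, ∀ γ ∈ ]0, γ₁], ∃ P, (D.C P).flow.InInterval γ P.K` — `γ₁ := γ₀`, the run `⟨K, m, g₀⟩` of module 8's K-indexed window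
(`N24_window_allK_of_betaUpperH`, from `hhi` alone) at the caller's `K m`. [cite: Balaban1989LargeFieldII, Thm 1 p.355 + p.391; Balaban1987RG1, (0.4) p.253, (0.18)–(0.20) pp.255–256 and p.264 (bookkeeping + elementary window)] -/
theorem N24_stabilityB_itemShape₅C_knit_all₁₃_pinned (h : IsRecordOfRecord₅C F N D w) {γ₀ : ℝ} (hγ₀ : w.γ ≤ γ₀) (K m : ℕ)
    (slots₀₅ : ∀ θ : Stage5Params F N, θ.Admissible → D = datumOfRecord₅ F N θ → (∀ P, w.up P = upOfRecord₅C F N θ P) → ∀ P : B12.RunParams,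
      B8LeafR (θ.res.X P).d8 (θ.res.X P).L8 (θ.res.X P).C₂ (θ.res.X P).B₁' (θ.res.X P).B₀' (θ.res.X P).B₁ (θ.res.X P).B₂ (θ.res.X P).c₁
        (θ.res.X P).inp8 (θ.res.X P).B₀β (θ.res.X P).loc8 (θ.res.X P).fam8R (θ.res.X P).lan8 (θ.res.X P).cub8 (θ.res.X P).toAxial8)
    (slots₀₆ : ∀ θ : Stage5Params F N, θ.Admissible → D = datumOfRecord₅ F N θ → (∀ P, w.up P = upOfRecord₅C F N θ P) → ∀ P : B12.RunParams,
      B9LeafX (θ.res.Y P))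
    (slots₀₇ : ∀ θ : Stage5Params F N, θ.Admissible → D = datumOfRecord₅ F N θ → (∀ P, w.up P = upOfRecord₅C F N θ P) → ∀ P : B12.RunParams,
      B11Leaf (θ.res.Z P))
    (slots₀₈ : ∀ θ : Stage5Params F N, θ.Admissible → D = datumOfRecord₅ F N θ →
      (∀ P, w.up P = upOfRecord₅C F N θ P) → ∀ P : B12.RunParams,
        ∃ (Xc : PrintedCarriersR) (I : Type) (C : B10Assembly.Consts) (T : I → B10.TowerRun),
          Nonempty (∀ i, B10Assembly.LeafSystem C (T i)) ∧ θ.res.X P = Xc.withTowerRuns10 T)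
    (slots₀₉ : ∀ θ : Stage5Params F N, θ.Admissible → D = datumOfRecord₅ F N θ → (∀ P, w.up P = upOfRecord₅C F N θ P) → ∀ P : B12.RunParams,
      B12Sec2to5.Lemma4Printed (θ.res.X P).F12 (θ.res.X P).c12)
    (hT3 : ∀ P : B12.RunParams, (leavesP w P).smallCouplings → (leavesP w P).smallFieldInductive)
    (slots₁₀ : ∀ θ : Stage5Params F N, θ.Admissible → D = datumOfRecord₅ F N θ →
      (∀ P, w.up P = upOfRecord₅C F N θ P) → ∀ P : B12.RunParams,
        B9LeafX (θ.res.Y P) →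
          (B10.Thm1PrintedCompact (θ.res.X P).runs10 ∧ B10.Thm2Printed (θ.res.X P).runs10) →
            B11Leaf (θ.res.Z P) → B12Sec2to5.Lemma4Printed (θ.res.X P).F12 (θ.res.X P).c12 →
              B13.Lemma1Printed (θ.res.X P).S13 (θ.res.X P).c13 ∧ B13.Lemma2Printed (θ.res.X P).S13 (θ.res.X P).c13 ∧
                B13.Lemma3Printed (θ.res.X P).S13 (θ.res.X P).c13)
    (slots₁₁ : ∀ θ : Stage5Params F N, θ.Admissible → D = datumOfRecord₅ F N θ →
      (∀ P, w.up P = upOfRecord₅C F N θ P) → ∀ P : B12.RunParams,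
        ∃ S Scorr : (k : ℕ) → Density (F.P P.K) k (SU N) → Prop,
          (ROpLeaf (θ.res.V P) → B14.RAssumedP244 (θ.res.R P) Scorr S P.K) ∧
          (∀ k, k ≤ P.K → S k (densOfRecord₅ F N θ P k) → θ.res.S218 P k (densOfRecord₅ F N θ P k)) ∧
          ((leavesP w P).smallCouplings → S 0 (rhoZeroOfRecord F N P.K P.g0 (θ.res.E P))) ∧
          ((leavesP w P).b7 → (leavesP w P).b8 → (leavesP w P).b9 → (leavesP w P).b10 → (leavesP w P).b11 →
            (leavesP w P).smallCouplings → (leavesP w P).smallFieldInductive → (leavesP w P).flowControl →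
              ∀ k, k < P.K → S k (densOfRecord₅ F N θ P k) →
                Scorr (k + 1) (TrhoOfRecord F N P.K k (densOfRecord₅ F N θ P k))))
    (slots₁₂ : ∀ θ : Stage5Params F N, θ.Admissible → D = datumOfRecord₅ F N θ → (∀ P, w.up P = upOfRecord₅C F N θ P) → ∀ P : B12.RunParams,
      B15Leaf (θ.res.W P))
    (hR : ∀ P : B12.RunParams, (w.up P).rOperation)
    (hcor3 : ∃ (em ep : ℝ → ℝ) (R : B14Cor3.ReprFamily D.C),
      B14Cor3.LeafH D.C R w.γ ∧ B14Cor3.LeafU1 D.C R w.γ ∧ B14Cor3.LeafU2 D.C R w.γ ep ∧ B14Cor3.LeafL1 D.C R w.γ ∧ B14Cor3.LeafL2 D.C R w.γ em)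
    (hlo : FlowStep.BetaLowerH w.b γ₀ D.βfun) (hhi : FlowStep.BetaUpperH w.βup γ₀ D.βfun) :
    IsDatumOfRecord₀ F N D ∧ B16.EndStatementBPrinted D.C ∧
      ∃ γ₁ : ℝ, 0 < γ₁ ∧ ∀ γ : ℝ, 0 < γ → γ ≤ γ₁ → ∃ P : B12.RunParams, (D.C P).flow.InInterval γ P.K := by
  refine ⟨isDatumOfRecord₀_of_isRecordOfRecord₅C h,
    N24_at_record₅C_knit_all₁₃_pinned h hγ₀ slots₀₅ slots₀₆ slots₀₇ slots₀₈ slots₀₉ hT3 slots₁₀ slots₁₁ slots₁₂ hR hcor3 hlo hhi,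
    γ₀, (gamma_pos_of_isRecordOfRecord₅C h).trans_le hγ₀, fun γ hγ hγle => ?_⟩
  obtain ⟨g0, -, hrun⟩ := N24_window_allK_of_betaUpperH D hhi hγ hγle m K
  exact ⟨⟨K, m, g0⟩, hrun⟩

/-! ## §2. `₈C` twins by refinement (N09's Theorem-3 member displayed at the world; for N09 through n09-a's Stage-8 slots use module 14) -/

/-- **N24 · (B2) at the Stage-8 record, all thirteen children by name in the `₅C` display** (through `isRecordOfRecord₅C_of_isRecordOfRecord₈C`), β-box on `D.βfun` over `]0, γ₀]`.
[cite: Balaban1989LargeFieldII, Thm 1 p.355 + pp.387, 391; Balaban1987RG1, Thm 1 p.259, Thm 3 p.264, Lemma 4 (3.53) p.280, (1.22) p.264; Balaban1988Convergent, Thm 1 p.262, Cor. 3 (2.50) p.264 (bookkeeping over the Stage-8 record)] -/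
theorem N24_at_record₈C_knit_all₁₃_pinned (h : IsRecordOfRecord₈C F N D w) {γ₀ : ℝ} (hγ₀ : w.γ ≤ γ₀)
    (slots₀₅ : ∀ θ : Stage5Params F N, θ.Admissible → D = datumOfRecord₅ F N θ → (∀ P, w.up P = upOfRecord₅C F N θ P) → ∀ P : B12.RunParams,
      B8LeafR (θ.res.X P).d8 (θ.res.X P).L8 (θ.res.X P).C₂ (θ.res.X P).B₁' (θ.res.X P).B₀' (θ.res.X P).B₁ (θ.res.X P).B₂ (θ.res.X P).c₁
        (θ.res.X P).inp8 (θ.res.X P).B₀β (θ.res.X P).loc8 (θ.res.X P).fam8R (θ.res.X P).lan8 (θ.res.X P).cub8 (θ.res.X P).toAxial8)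
    (slots₀₆ : ∀ θ : Stage5Params F N, θ.Admissible → D = datumOfRecord₅ F N θ → (∀ P, w.up P = upOfRecord₅C F N θ P) → ∀ P : B12.RunParams,
      B9LeafX (θ.res.Y P))
    (slots₀₇ : ∀ θ : Stage5Params F N, θ.Admissible → D = datumOfRecord₅ F N θ → (∀ P, w.up P = upOfRecord₅C F N θ P) → ∀ P : B12.RunParams,
      B11Leaf (θ.res.Z P))
    (slots₀₈ : ∀ θ : Stage5Params F N, θ.Admissible → D = datumOfRecord₅ F N θ →
      (∀ P, w.up P = upOfRecord₅C F N θ P) → ∀ P : B12.RunParams,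
        ∃ (Xc : PrintedCarriersR) (I : Type) (C : B10Assembly.Consts) (T : I → B10.TowerRun),
          Nonempty (∀ i, B10Assembly.LeafSystem C (T i)) ∧ θ.res.X P = Xc.withTowerRuns10 T)
    (slots₀₉ : ∀ θ : Stage5Params F N, θ.Admissible → D = datumOfRecord₅ F N θ → (∀ P, w.up P = upOfRecord₅C F N θ P) → ∀ P : B12.RunParams,
      B12Sec2to5.Lemma4Printed (θ.res.X P).F12 (θ.res.X P).c12)
    (hT3 : ∀ P : B12.RunParams, (leavesP w P).smallCouplings → (leavesP w P).smallFieldInductive)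
    (slots₁₀ : ∀ θ : Stage5Params F N, θ.Admissible → D = datumOfRecord₅ F N θ →
      (∀ P, w.up P = upOfRecord₅C F N θ P) → ∀ P : B12.RunParams,
        B9LeafX (θ.res.Y P) →
          (B10.Thm1PrintedCompact (θ.res.X P).runs10 ∧ B10.Thm2Printed (θ.res.X P).runs10) →
            B11Leaf (θ.res.Z P) → B12Sec2to5.Lemma4Printed (θ.res.X P).F12 (θ.res.X P).c12 →
              B13.Lemma1Printed (θ.res.X P).S13 (θ.res.X P).c13 ∧ B13.Lemma2Printed (θ.res.X P).S13 (θ.res.X P).c13 ∧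
                B13.Lemma3Printed (θ.res.X P).S13 (θ.res.X P).c13)
    (slots₁₁ : ∀ θ : Stage5Params F N, θ.Admissible → D = datumOfRecord₅ F N θ →
      (∀ P, w.up P = upOfRecord₅C F N θ P) → ∀ P : B12.RunParams,
        ∃ S Scorr : (k : ℕ) → Density (F.P P.K) k (SU N) → Prop,
          (ROpLeaf (θ.res.V P) → B14.RAssumedP244 (θ.res.R P) Scorr S P.K) ∧
          (∀ k, k ≤ P.K → S k (densOfRecord₅ F N θ P k) → θ.res.S218 P k (densOfRecord₅ F N θ P k)) ∧
          ((leavesP w P).smallCouplings → S 0 (rhoZeroOfRecord F N P.K P.g0 (θ.res.E P))) ∧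
          ((leavesP w P).b7 → (leavesP w P).b8 → (leavesP w P).b9 → (leavesP w P).b10 → (leavesP w P).b11 →
            (leavesP w P).smallCouplings → (leavesP w P).smallFieldInductive → (leavesP w P).flowControl →
              ∀ k, k < P.K → S k (densOfRecord₅ F N θ P k) →
                Scorr (k + 1) (TrhoOfRecord F N P.K k (densOfRecord₅ F N θ P k))))
    (slots₁₂ : ∀ θ : Stage5Params F N, θ.Admissible → D = datumOfRecord₅ F N θ → (∀ P, w.up P = upOfRecord₅C F N θ P) → ∀ P : B12.RunParams,
      B15Leaf (θ.res.W P))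
    (hR : ∀ P : B12.RunParams, (w.up P).rOperation)
    (hcor3 : ∃ (em ep : ℝ → ℝ) (R : B14Cor3.ReprFamily D.C),
      B14Cor3.LeafH D.C R w.γ ∧ B14Cor3.LeafU1 D.C R w.γ ∧ B14Cor3.LeafU2 D.C R w.γ ep ∧ B14Cor3.LeafL1 D.C R w.γ ∧ B14Cor3.LeafL2 D.C R w.γ em)
    (hlo : FlowStep.BetaLowerH w.b γ₀ D.βfun) (hhi : FlowStep.BetaUpperH w.βup γ₀ D.βfun) :
    B16.EndStatementBPrinted D.C :=
  N24_at_record₅C_knit_all₁₃_pinned (isRecordOfRecord₅C_of_isRecordOfRecord₈C h) hγ₀ slots₀₅ slots₀₆ slots₀₇ slots₀₈ slots₀₉ hT3 slots₁₀ slots₁₁ slots₁₂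
    hR hcor3 hlo hhi

/-- **The same with the β-binders READ AT THE MERGED β OF RECORD along the world's box `]0, w.γ]^{k+1}`** (module 10's `N24_betaLowerH_iff_merged₈` ∕ `N24_betaUpperH_iff_merged₈`).
[cite: Balaban1989LargeFieldII, Thm 1 p.355 + pp.387, 391; Balaban1987RG1, (1.20)–(1.22) p.264, (2.12)–(2.14) p.268, Thm 1 p.259, Thm 3 p.264, Lemma 4 (3.53) p.280; Balaban1988Convergent, Thm 1 p.262, Cor. 3 (2.50) p.264 (bookkeeping over the Stage-8 record)] -/
theorem N24_at_record₈C_knit_all₁₃_of_betaMerged_pinned (h : IsRecordOfRecord₈C F N D w)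
    (slots₀₅ : ∀ θ : Stage5Params F N, θ.Admissible → D = datumOfRecord₅ F N θ → (∀ P, w.up P = upOfRecord₅C F N θ P) → ∀ P : B12.RunParams,
      B8LeafR (θ.res.X P).d8 (θ.res.X P).L8 (θ.res.X P).C₂ (θ.res.X P).B₁' (θ.res.X P).B₀' (θ.res.X P).B₁ (θ.res.X P).B₂ (θ.res.X P).c₁
        (θ.res.X P).inp8 (θ.res.X P).B₀β (θ.res.X P).loc8 (θ.res.X P).fam8R (θ.res.X P).lan8 (θ.res.X P).cub8 (θ.res.X P).toAxial8)
    (slots₀₆ : ∀ θ : Stage5Params F N, θ.Admissible → D = datumOfRecord₅ F N θ → (∀ P, w.up P = upOfRecord₅C F N θ P) → ∀ P : B12.RunParams,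
      B9LeafX (θ.res.Y P))
    (slots₀₇ : ∀ θ : Stage5Params F N, θ.Admissible → D = datumOfRecord₅ F N θ → (∀ P, w.up P = upOfRecord₅C F N θ P) → ∀ P : B12.RunParams,
      B11Leaf (θ.res.Z P))
    (slots₀₈ : ∀ θ : Stage5Params F N, θ.Admissible → D = datumOfRecord₅ F N θ →
      (∀ P, w.up P = upOfRecord₅C F N θ P) → ∀ P : B12.RunParams,
        ∃ (Xc : PrintedCarriersR) (I : Type) (C : B10Assembly.Consts) (T : I → B10.TowerRun),
          Nonempty (∀ i, B10Assembly.LeafSystem C (T i)) ∧ θ.res.X P = Xc.withTowerRuns10 T)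
    (slots₀₉ : ∀ θ : Stage5Params F N, θ.Admissible → D = datumOfRecord₅ F N θ → (∀ P, w.up P = upOfRecord₅C F N θ P) → ∀ P : B12.RunParams,
      B12Sec2to5.Lemma4Printed (θ.res.X P).F12 (θ.res.X P).c12)
    (hT3 : ∀ P : B12.RunParams, (leavesP w P).smallCouplings → (leavesP w P).smallFieldInductive)
    (slots₁₀ : ∀ θ : Stage5Params F N, θ.Admissible → D = datumOfRecord₅ F N θ →
      (∀ P, w.up P = upOfRecord₅C F N θ P) → ∀ P : B12.RunParams,
        B9LeafX (θ.res.Y P) →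
          (B10.Thm1PrintedCompact (θ.res.X P).runs10 ∧ B10.Thm2Printed (θ.res.X P).runs10) →
            B11Leaf (θ.res.Z P) → B12Sec2to5.Lemma4Printed (θ.res.X P).F12 (θ.res.X P).c12 →
              B13.Lemma1Printed (θ.res.X P).S13 (θ.res.X P).c13 ∧ B13.Lemma2Printed (θ.res.X P).S13 (θ.res.X P).c13 ∧
                B13.Lemma3Printed (θ.res.X P).S13 (θ.res.X P).c13)
    (slots₁₁ : ∀ θ : Stage5Params F N, θ.Admissible → D = datumOfRecord₅ F N θ →
      (∀ P, w.up P = upOfRecord₅C F N θ P) → ∀ P : B12.RunParams,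
        ∃ S Scorr : (k : ℕ) → Density (F.P P.K) k (SU N) → Prop,
          (ROpLeaf (θ.res.V P) → B14.RAssumedP244 (θ.res.R P) Scorr S P.K) ∧
          (∀ k, k ≤ P.K → S k (densOfRecord₅ F N θ P k) → θ.res.S218 P k (densOfRecord₅ F N θ P k)) ∧
          ((leavesP w P).smallCouplings → S 0 (rhoZeroOfRecord F N P.K P.g0 (θ.res.E P))) ∧
          ((leavesP w P).b7 → (leavesP w P).b8 → (leavesP w P).b9 → (leavesP w P).b10 → (leavesP w P).b11 →
            (leavesP w P).smallCouplings → (leavesP w P).smallFieldInductive → (leavesP w P).flowControl →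
              ∀ k, k < P.K → S k (densOfRecord₅ F N θ P k) →
                Scorr (k + 1) (TrhoOfRecord F N P.K k (densOfRecord₅ F N θ P k))))
    (slots₁₂ : ∀ θ : Stage5Params F N, θ.Admissible → D = datumOfRecord₅ F N θ → (∀ P, w.up P = upOfRecord₅C F N θ P) → ∀ P : B12.RunParams,
      B15Leaf (θ.res.W P))
    (hR : ∀ P : B12.RunParams, (w.up P).rOperation)
    (hcor3 : ∃ (em ep : ℝ → ℝ) (R : B14Cor3.ReprFamily D.C),
      B14Cor3.LeafH D.C R w.γ ∧ B14Cor3.LeafU1 D.C R w.γ ∧ B14Cor3.LeafU2 D.C R w.γ ep ∧ B14Cor3.LeafL1 D.C R w.γ ∧ B14Cor3.LeafL2 D.C R w.γ em)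
    (hβm : ∀ θ : Stage8Params F N, θ.Admissible → D = datumOfRecord₅ F N (θ.toStage5 F N) → w.γ ≤ θ.γ →
      letI := θ.instVβ₁; letI := θ.instVβ₂; letI := θ.instιβ
      FlowStep.BetaLowerH w.b w.γ (betaMerged F (mergedTermFamilyMat F N (chi7 F N θ) θ.εbg) θ.ρ8 θ.bV) ∧
        FlowStep.BetaUpperH w.βup w.γ (betaMerged F (mergedTermFamilyMat F N (chi7 F N θ) θ.εbg) θ.ρ8 θ.bV)) :
    B16.EndStatementBPrinted D.C := by
  obtain ⟨θ, hθ, hD, -, hγ, -, -⟩ := id h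
  obtain ⟨hlo, hhi⟩ := hβm θ hθ hD hγ.2
  exact N24_at_record₈C_knit_all₁₃_pinned h le_rfl slots₀₅ slots₀₆ slots₀₇ slots₀₈ slots₀₉ hT3 slots₁₀ slots₁₁ slots₁₂ hR hcor3
    ((N24_betaLowerH_iff_merged₈ θ hD hγ.2).mpr hlo) ((N24_betaUpperH_iff_merged₈ θ hD hγ.2).mpr hhi)

/-! ## §3. GIVEN B3 at `₅C`: the γ-blind sockets at `w`, the γ-reading hypotheses at the lowered world -/

/-- **N24 at the Stage-5 record of record GIVEN B3, every child by name.**  From a `₅C` record `(D, w)`, B3 at `D.βfun` (`0 < β̄`, `BetaPertH D.βfun β̄`), the seven γ-BLIND carrier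
sockets ∕ slots at `w` (N05 N06 N07 N08 N09-`b12` N10 N12: they read only `w.up`) and N13's 𝐑-leaf, there is an explicit γ-LOWERED `₅C` record world `w'` over `D` (same `C`, `up`, `L`,
exponent letters; `γ := min w.γ γᵦ`; `(b, β⁺)` := B3's box bounds — module 12's `N24_betaBox_of_betaPertH`, module 5's `N24_isRecordOfRecord₅C_reletter`) at which «N09's Theorem-3
member + N11's slots + N13's ∃ (e₋, e₊) R Cor.-3 leaves at `(D.C, w'.γ)` (displayed AT `w'`: they read the window) ⇒ `B16.EndStatementBPrinted D.C`» — §1 at `w'` with the B3 bounds on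
`]0, w'.γ]` by `FlowStep.box_mono`; no separate β-binder (B3 is NODE O's; no typed realiser satisfies it yet — ref-D N-n24-12).
[cite: Balaban1989LargeFieldII, Thm 1 p.355 + pp.387, 391 («γ sufficiently small»); Balaban1987RG1, (1.22) p.264, Thm 1 p.259, Thm 3 p.264, Lemma 4 (3.53) p.280; Balaban1988Convergent, Thm 1 p.262, p.244, Cor. 3 (2.50) p.264 (bookkeeping over the Stage-5 record of record)] -/
theorem N24_lowered_slots₅C_of_betaPertH_pinned (h : IsRecordOfRecord₅C F N D w) {βbar : ℝ} (hbar : 0 < βbar) (hP : BetaPertH D.βfun βbar)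
    (slots₀₅ : ∀ θ : Stage5Params F N, θ.Admissible → D = datumOfRecord₅ F N θ → (∀ P, w.up P = upOfRecord₅C F N θ P) → ∀ P : B12.RunParams,
      B8LeafR (θ.res.X P).d8 (θ.res.X P).L8 (θ.res.X P).C₂ (θ.res.X P).B₁' (θ.res.X P).B₀' (θ.res.X P).B₁ (θ.res.X P).B₂ (θ.res.X P).c₁
        (θ.res.X P).inp8 (θ.res.X P).B₀β (θ.res.X P).loc8 (θ.res.X P).fam8R (θ.res.X P).lan8 (θ.res.X P).cub8 (θ.res.X P).toAxial8)
    (slots₀₆ : ∀ θ : Stage5Params F N, θ.Admissible → D = datumOfRecord₅ F N θ → (∀ P, w.up P = upOfRecord₅C F N θ P) → ∀ P : B12.RunParams,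
      B9LeafX (θ.res.Y P))
    (slots₀₇ : ∀ θ : Stage5Params F N, θ.Admissible → D = datumOfRecord₅ F N θ → (∀ P, w.up P = upOfRecord₅C F N θ P) → ∀ P : B12.RunParams,
      B11Leaf (θ.res.Z P))
    (slots₀₈ : ∀ θ : Stage5Params F N, θ.Admissible → D = datumOfRecord₅ F N θ →
      (∀ P, w.up P = upOfRecord₅C F N θ P) → ∀ P : B12.RunParams,
        ∃ (Xc : PrintedCarriersR) (I : Type) (C : B10Assembly.Consts) (T : I → B10.TowerRun),
          Nonempty (∀ i, B10Assembly.LeafSystem C (T i)) ∧ θ.res.X P = Xc.withTowerRuns10 T)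
    (slots₀₉ : ∀ θ : Stage5Params F N, θ.Admissible → D = datumOfRecord₅ F N θ → (∀ P, w.up P = upOfRecord₅C F N θ P) → ∀ P : B12.RunParams,
      B12Sec2to5.Lemma4Printed (θ.res.X P).F12 (θ.res.X P).c12)
    (slots₁₀ : ∀ θ : Stage5Params F N, θ.Admissible → D = datumOfRecord₅ F N θ →
      (∀ P, w.up P = upOfRecord₅C F N θ P) → ∀ P : B12.RunParams,
        B9LeafX (θ.res.Y P) →
          (B10.Thm1PrintedCompact (θ.res.X P).runs10 ∧ B10.Thm2Printed (θ.res.X P).runs10) →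
            B11Leaf (θ.res.Z P) → B12Sec2to5.Lemma4Printed (θ.res.X P).F12 (θ.res.X P).c12 →
              B13.Lemma1Printed (θ.res.X P).S13 (θ.res.X P).c13 ∧ B13.Lemma2Printed (θ.res.X P).S13 (θ.res.X P).c13 ∧
                B13.Lemma3Printed (θ.res.X P).S13 (θ.res.X P).c13)
    (slots₁₂ : ∀ θ : Stage5Params F N, θ.Admissible → D = datumOfRecord₅ F N θ → (∀ P, w.up P = upOfRecord₅C F N θ P) → ∀ P : B12.RunParams,
      B15Leaf (θ.res.W P))
    (hR : ∀ P : B12.RunParams, (w.up P).rOperation) :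
    ∃ w' : WorldP, IsRecordOfRecord₅C F N D w' ∧ w'.C = w.C ∧ w'.up = w.up ∧ w'.L = w.L ∧ w'.em = w.em ∧ w'.ep = w.ep ∧
      0 < w'.γ ∧ w'.γ ≤ w.γ ∧
      ((∀ P : B12.RunParams, (leavesP w' P).smallCouplings → (leavesP w' P).smallFieldInductive) →
        (∀ θ : Stage5Params F N, θ.Admissible → D = datumOfRecord₅ F N θ →
          (∀ P, w'.up P = upOfRecord₅C F N θ P) → ∀ P : B12.RunParams,
            ∃ S Scorr : (k : ℕ) → Density (F.P P.K) k (SU N) → Prop,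
              (ROpLeaf (θ.res.V P) → B14.RAssumedP244 (θ.res.R P) Scorr S P.K) ∧
              (∀ k, k ≤ P.K → S k (densOfRecord₅ F N θ P k) → θ.res.S218 P k (densOfRecord₅ F N θ P k)) ∧
              ((leavesP w' P).smallCouplings → S 0 (rhoZeroOfRecord F N P.K P.g0 (θ.res.E P))) ∧
              ((leavesP w' P).b7 → (leavesP w' P).b8 → (leavesP w' P).b9 → (leavesP w' P).b10 → (leavesP w' P).b11 →
                (leavesP w' P).smallCouplings → (leavesP w' P).smallFieldInductive → (leavesP w' P).flowControl →
                  ∀ k, k < P.K → S k (densOfRecord₅ F N θ P k) →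
                    Scorr (k + 1) (TrhoOfRecord F N P.K k (densOfRecord₅ F N θ P k)))) →
        (∃ (em ep : ℝ → ℝ) (R : B14Cor3.ReprFamily D.C),
          B14Cor3.LeafH D.C R w'.γ ∧ B14Cor3.LeafU1 D.C R w'.γ ∧ B14Cor3.LeafU2 D.C R w'.γ ep ∧ B14Cor3.LeafL1 D.C R w'.γ ∧
            B14Cor3.LeafL2 D.C R w'.γ em) →
        B16.EndStatementBPrinted D.C) := by
  obtain ⟨γβ, b, βup, hγβ, hb, hlo, hhi⟩ := N24_betaBox_of_betaPertH hbar hP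
  have hwγ : 0 < w.γ := gamma_pos_of_isRecordOfRecord₅C h
  have hγ' : 0 < min w.γ γβ := lt_min hwγ hγβ
  have h' : IsRecordOfRecord₅C F N D { w with γ := min w.γ γβ, b := b, b_pos := hb, βup := βup, em := w.em, ep := w.ep } :=
    N24_isRecordOfRecord₅C_reletter h hγ' hb βup w.em w.ep
  refine ⟨{ w with γ := min w.γ γβ, b := b, b_pos := hb, βup := βup, em := w.em, ep := w.ep }, h', rfl, rfl, rfl, rfl, rfl, hγ',
    min_le_left _ _, fun hT3 slots₁₁ hcor3 => ?_⟩
  exact N24_at_record₅C_knit_all₁₃_pinned h' le_rfl slots₀₅ slots₀₆ slots₀₇ slots₀₈ slots₀₉ hT3 slots₁₀ slots₁₁ slots₁₂ hR hcor3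
    (fun k v hv => hlo k v (box_mono (min_le_right _ _) k hv)) fun k v hv => hhi k v (box_mono (min_le_right _ _) k hv)

end Literature.MathematicalPhysics.QuantumFieldTheory.Balaban1983to89.Node00

end
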